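/-
Copyright (c) 2026. All rights reserved.
Released under Apache 2.0 license as described in the file LICENSE.
Authors: abc-iut cell, prover seat abc-iut-w5-d097 (wave 5), over the statements of abc-iut-L4-t3.
-/
import Literature.AnabelianGeometry.AbsoluteAnabelian.LogFrobeniusLogWallTSNonVacuity
import Literature.AnabelianGeometry.AbsoluteAnabelian.LogFrobeniusNotSimCompatOfObstruction
import HarnessLib

/-!
# [AbsTopIII] Corollary 5.5 (iv), second sentence (`Cor55NotSimultaneouslyCompatible`, FACT-LIST F-3190): kernel
# NON-VACUITY over every index set with a nonarchimedean place

S. Mochizuki, *Topics in absolute anabelian geometry III: global reconstruction algorithms*,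
J. Math. Sci. Univ. Tokyo 22 (2015) 939–1156 [MochizukiAbsTopIII2015]; locators `p.N` = pages of the author's manuscript
(`paper:url-5493eb38cbb7`): Def 5.4 (iii), (vii) pp. 126–128; Cor 5.5 (iv) p. 131 (second sentence: "the telecore structure
`𝔗_{An•}` of (ii), the contact structure `ℋ_{An•}` of (ii), and the observables `S_log`, `S_log⊞` of (iii) are not simultaneously
compatible"); Lemma 3.4 p. 74 (the nonarchimedean mechanism).

PROOF-ONLY companion (theorems only; nothing restated) of abc-iut-L4-t3's `LogFrobeniusIncompatibility.lean` (the typed second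
sentence `LogFrobeniusSetting.Cor55NotSimultaneouslyCompatible L T` = F-3190), of this seat's reduction
`cor55NotSimultaneouslyCompatible_of_nonarchObstruction` (`LogFrobeniusNotSimCompatOfObstruction.lean`, p427602) and of
abc-iut-w4-d095's calibration file `LogFrobeniusLogWallTSNonVacuity.lean` (p429759: the PLAIN diagonal setting on a preadditive
large category `C` with the `TS`-homotopies `twistTS` — identity identifications except ZERO on the space-link arrow `k̄^× ↪ k̄` of
`Γ⃗^log_non` — satisfies this seat's nonarchimedean two-path obstruction, hence the first sentence `Cor55LogWall`).  Since the
reductions of the FIRST and of the SECOND sentence have LITERALLY the same antecedent, the same witness calibrates F-3190: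

* `exists_cor55iv_of_nonarch` — over a preadditive `C` with `𝟙 x₀ ≠ 0` and a nonarchimedean `v₀`, the pair (diagonal setting,
  `twistTS`) satisfies BOTH typed sentences of Cor 5.5 (iv): `Cor55LogWall ∧ Cor55NotSimultaneouslyCompatible` (the obstruction is
  verified once — `ι_{k̄^× ↪ k̄} = 0` kills the composite, `ι_{𝒪^× →(log) k~}` at `x₀` is the identity — and fed to both
  reductions);
* `exists_cor55NotSimultaneouslyCompatible` — F-3190 is SATISFIABLE together with the interface over every index set with a
  nonarchimedean place (`AddCommGrpCat.{u}`, `x₀ := ℤ`): the typed second sentence is not refutable from the typing of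
  `LogFrobeniusSetting` / `TSHomotopies`, i.e. it is correctly carried as a NAMED HYPOTHESIS quoting print.  (Whether it FAILS at
  some setting — full independence — needs a telecore with contact structure and observables inside one family at the diagonal
  setting; not in this file.  At an archimedean-only index set a witness would need the archimedean reduction of the second
  sentence, not in the tree.)

HONEST LABEL: a DEGENERATE calibration witness (no arithmetic content; zero natural transformations are not print's `ι`); it
calibrates the typed statement only.  Refereed pre-IUT material; nothing here bears on [IUTchIII] Cor. 3.12; OUR kernel check;
no side taken.
-/

set_option autoImplicit false

universe u

open CategoryTheory Quiver

namespace Literature.AnabelianGeometry.AbsoluteAnabelian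

namespace LogFrobeniusSetting

section Lemmas

variable {C : Type (u + 1)} [Category.{u} C]

/-- Whiskering an `eqToHom` of functors on the right is an `eqToHom`. [folklore] -/
private theorem whiskerRight_eqToHom'' {A B B' : Type*} [Category A] [Category B] [Category B'] {F G : A ⥤ B}
    (h : F = G) (R : B ⥤ B') :
    Functor.whiskerRight (eqToHom h) R = eqToHom (show F ⋙ R = G ⋙ R by rw [h]) := by
  subst h
  rw [eqToHom_refl, Functor.whiskerRight_id', eqToHom_refl]

/-- A morphism `m : x ⟶ x` heterogeneously equal to a component of an `eqToHom` between functors equal to `𝟭` is the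
identity. [folklore] -/
private theorem eq_id_of_heq_eqToHom_app' {F G : C ⥤ C} (hF : F = 𝟭 C) (hG : G = 𝟭 C) (E : F = G) (x : C) (m : x ⟶ x)
    (h : HEq m ((eqToHom E).app x)) : m = 𝟙 x := by
  subst hF hG
  rw [eqToHom_refl, NatTrans.id_app] at h
  exact eq_of_heq h

variable [Preadditive C]

/-- A morphism `m : x ⟶ x` heterogeneously equal to a component of the ZERO natural transformation between functors equal to
`𝟭` is zero. [folklore] -/
private theorem eq_zero_of_heq_zero_app' {F G : C ⥤ C} (hF : F = 𝟭 C) (hG : G = 𝟭 C) (y x : C) (hy : y = x) (m : x ⟶ x)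
    (h : HEq m ((0 : F ⟶ G).app y)) : m = 0 := by
  subst hF hG hy
  rw [NatTrans.app_zero] at h
  exact eq_of_heq h

/-- `𝟙_ℤ ≠ 0` in `AddCommGrpCat.{u}`. [folklore] -/
private theorem id_ulift_int_ne_zero' :
    (𝟙 (AddCommGrpCat.of (ULift.{u} ℤ)) : AddCommGrpCat.of (ULift.{u} ℤ) ⟶ AddCommGrpCat.of (ULift.{u} ℤ)) ≠ 0 := by
  intro h
  have h1 := congrArg (fun f : AddCommGrpCat.of (ULift.{u} ℤ) ⟶ AddCommGrpCat.of (ULift.{u} ℤ) =>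
    (f.hom (ULift.up 1)).down) h
  simp at h1

end Lemmas

variable (Vmod : Type u) (isArc : Vmod → Bool)

/-- **BOTH sentences of [AbsTopIII] Cor 5.5 (iv) at one (degenerate) setting**: over a preadditive large category `C` with an
object `x₀`, `𝟙 x₀ ≠ 0`, and a NONARCHIMEDEAN place `v₀`, the plain diagonal setting (all rows `C`, all structure functors `𝟭 C`,
`ι⊞` the identity identifications) with abc-iut-w4-d095's `TS`-homotopies `twistTS` (identity identifications except ZERO on
`k̄^× ↪ k̄`) satisfies the nonarchimedean two-path obstruction — `λ(a) ≫ ι_{ε₁} ≫ ι_{ε₂} ≫ ι_{ε₃}` passes through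
`ι_{k̄^× ↪ k̄} = 0` while `ι_{𝒪^× →(log) k~}` at `x₀` is `𝟙 x₀ ≠ 0` — hence, by this seat's two reductions with the SAME antecedent,
the print-faithful first sentence `Cor55LogWall` AND the second sentence `Cor55NotSimultaneouslyCompatible`.  DEGENERATE calibration
witness. [cite: MochizukiAbsTopIII2015, Cor 5.5 (iv) p. 131] -/
theorem exists_cor55iv_of_nonarch (C : Type (u + 1)) [Category.{u} C] [Preadditive C] (x₀ : C)
    (hx₀ : (𝟙 x₀ : x₀ ⟶ x₀) ≠ 0) (v₀ : Vmod) (hv₀ : isArc v₀ = false) :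
    ∃ (L : LogFrobeniusSetting Vmod isArc) (T : L.TSHomotopies), L.X = C ∧ L.Cor55LogWall T ∧
      L.Cor55NotSimultaneouslyCompatible T := by
  let L₁ : LogFrobeniusSetting Vmod isArc :=
    { X := C
      E := C
      proj := 𝟭 C
      log := 𝟭 C
      logIsoId := Iso.refl _
      logOver := Iso.refl _
      Nplus := fun _ => C
      N := fun _ => C
      forget := fun _ => 𝟭 C
      toE := fun _ => 𝟭 C
      lam := fun _ _ => 𝟭 C
      lamOver := fun _ _ => Iso.refl _
      lam_spaceLink_eq_postLog := fun _ => rfl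
      iota := fun _ ν₁ _ _ => eqToHom (frobeniusTwist_id_comp_id_eq ν₁.isPostLog)
      An := C
      κAn := CategoryTheory.Equivalence.refl
      φAn := 𝟭 C
      φAn_isEquivalence := inferInstance
      ηAn := Iso.refl _
      κAn₂ := CategoryTheory.Equivalence.refl
      Emono := C
      monoAn := 𝟭 C
      NmonoPlus := fun _ => C
      Nmono := fun _ => C
      forgetMono := fun _ => 𝟭 C
      toEmono := fun _ => 𝟭 C
      monoNplus := fun _ => 𝟭 C
      monoN := fun _ => 𝟭 C
      monoHomotopy := fun _ => Iso.refl _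
      AnMono := C
      κAnMono := CategoryTheory.Equivalence.refl
      ψAnMono := fun _ _ => 𝟭 C }
  let T₁ : L₁.TSHomotopies :=
    { iota := fun v ν₁ ν₂ ε => twistTS C (isArc v) ν₁ ν₂ ε
      iota_toTS := fun v ν₁ ν₂ ε => by
        change twistTS C (isArc v) ν₁ ν₂ ε.toTS =
          Functor.whiskerRight (eqToHom (frobeniusTwist_id_comp_id_eq ν₁.isPostLog)) (𝟭 C)
        rw [twistTS_toTS, whiskerRight_eqToHom''] }
  -- the nonarchimedean two-path obstruction at `x₀`, verified ONCE for both reductions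
  have obstruction : ∀ (νu νm νc : LogVertex (isArc v₀)) (_ : νu.isPostLog = false) (_ : νm.isPostLog = false)
      (_ : νc.isPostLog = false) (ε₁ : LogEdgeTS (isArc v₀) νu νm)
      (ε₂ : LogEdgeTS (isArc v₀) νm (LogVertex.spaceLink (isArc v₀)))
      (ε₃ : LogEdgeTS (isArc v₀) (LogVertex.postLog (isArc v₀)) νc) (ε₄ : LogEdgeTS (isArc v₀) νu νc)
      (a : x₀ ⟶ L₁.log.obj x₀), IsIso a →
      ∀ (m₁ : (L₁.lam v₀ νu ⋙ L₁.forget v₀).obj (L₁.log.obj x₀) ⟶ (L₁.lam v₀ νm ⋙ L₁.forget v₀).obj (L₁.log.obj x₀))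
        (m₂ : (L₁.lam v₀ νm ⋙ L₁.forget v₀).obj (L₁.log.obj x₀) ⟶
          (L₁.lam v₀ (LogVertex.spaceLink (isArc v₀)) ⋙ L₁.forget v₀).obj (L₁.log.obj x₀))
        (m₃ : (L₁.lam v₀ (LogVertex.spaceLink (isArc v₀)) ⋙ L₁.forget v₀).obj (L₁.log.obj x₀) ⟶
          (L₁.lam v₀ νc ⋙ L₁.forget v₀).obj x₀)
        (m₄ : (L₁.lam v₀ νu ⋙ L₁.forget v₀).obj x₀ ⟶ (L₁.lam v₀ νc ⋙ L₁.forget v₀).obj x₀),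
        HEq m₁ ((T₁.iota v₀ ε₁).app (L₁.log.obj x₀)) → HEq m₂ ((T₁.iota v₀ ε₂).app (L₁.log.obj x₀)) →
        HEq m₃ ((T₁.iota v₀ ε₃).app x₀) → HEq m₄ ((T₁.iota v₀ ε₄).app x₀) →
          (L₁.lam v₀ νu ⋙ L₁.forget v₀).map a ≫ m₁ ≫ m₂ ≫ m₃ ≠ m₄ := by
    intro νu νm νc hu _ _ ε₁ ε₂ ε₃ ε₄ a _ m₁ m₂ m₃ m₄ _ hm₂ _ hm₄
    -- `ι_{ε₂} = 0` (arrow into the space-link vertex at a nonarchimedean place)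
    have h₂ : m₂ = 0 := by
      change HEq m₂ ((twistTS C (isArc v₀) νm _ ε₂).app _) at hm₂
      rw [twistTS_spaceLink_eq_zero C (isArc v₀) hv₀] at hm₂
      exact eq_zero_of_heq_zero_app' (frobeniusTwist_id_comp_id_comp_id_eq (C := C) νm.isPostLog) rfl _ x₀ rfl m₂ hm₂
    -- `ι_{ε₄}` at `x₀` is the identity
    have h₄ : m₄ = 𝟙 x₀ := by
      change HEq m₄ ((twistTS C (isArc v₀) νu νc ε₄).app x₀) at hm₄
      rw [twistTS_eq_eqToHom C (isArc v₀) hv₀ νu νc ε₃ ε₄] at hm₄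
      exact eq_id_of_heq_eqToHom_app' (frobeniusTwist_id_comp_id_comp_id_eq (C := C) νu.isPostLog) rfl _ x₀ m₄ hm₄
    rw [h₂, h₄, Limits.zero_comp, Limits.comp_zero, Limits.comp_zero]
    exact fun h => hx₀ h.symm
  exact ⟨L₁, T₁, rfl, L₁.cor55LogWall_of_nonarchObstruction T₁ v₀ hv₀ x₀ obstruction,
    L₁.cor55NotSimultaneouslyCompatible_of_nonarchObstruction T₁ v₀ hv₀ x₀ obstruction⟩

/-- **F-3190 `Cor55NotSimultaneouslyCompatible` is SATISFIABLE together with the interface over every index set with a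
NONARCHIMEDEAN place** (`AddCommGrpCat.{u}`, `x₀ := ℤ`), simultaneously with the first sentence F-3082 `Cor55LogWall`: the typed
second sentence of Cor 5.5 (iv) is not refutable from the typing — correctly a NAMED HYPOTHESIS quoting print.
[cite: MochizukiAbsTopIII2015, Cor 5.5 (iv) p. 131] -/
theorem exists_cor55NotSimultaneouslyCompatible (v₀ : Vmod) (hv₀ : isArc v₀ = false) :
    ∃ (L : LogFrobeniusSetting Vmod isArc) (T : L.TSHomotopies), L.Cor55LogWall T ∧ L.Cor55NotSimultaneouslyCompatible T := by
  obtain ⟨L, T, -, h₁, h₂⟩ := exists_cor55iv_of_nonarch Vmod isArc AddCommGrpCat.{u} _ id_ulift_int_ne_zero' v₀ hv₀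
  exact ⟨L, T, h₁, h₂⟩

/-- **F-3190 as a closed EXISTENTIAL holds**: there are an index set (one nonarchimedean place), a setting and `TS`-homotopies at
which both sentences of Cor 5.5 (iv) hold as typed — so neither `¬ Cor55NotSimultaneouslyCompatible` nor `¬ Cor55LogWall` is a
theorem of the interface. [cite: MochizukiAbsTopIII2015, Cor 5.5 (iv) p. 131] -/
theorem exists_setting_cor55iv :
    ∃ (Vmod : Type u) (isArc : Vmod → Bool) (L : LogFrobeniusSetting Vmod isArc) (T : L.TSHomotopies),
      L.Cor55LogWall T ∧ L.Cor55NotSimultaneouslyCompatible T := by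
  obtain ⟨L, T, h⟩ := exists_cor55NotSimultaneouslyCompatible PUnit.{u + 1} (fun _ => false) PUnit.unit rfl
  exact ⟨_, _, L, T, h⟩

end LogFrobeniusSetting

end Literature.AnabelianGeometry.AbsoluteAnabelian
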